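import Summits.Ventures.CertifiedManyBodySolver.Observables.PhaseSeparationExclusionEDopedFarColumnsB
import Summits.Ventures.CertifiedManyBodySolver.Observables.PhaseSeparationExclusionParticleHoleColumns
import Summits.Ventures.CertifiedManyBodySolver.Observables.PhaseSeparationExclusionTPrimeStripThermal
import Summits.Ventures.CertifiedManyBodySolver.Observables.PhaseSeparationExclusionTPrimeStripTwoFifthsThermal
import Summits.Ventures.CertifiedManyBodySolver.Observables.PhaseSeparationExclusionMidSegmentCapThermal
import Summits.Ventures.CertifiedManyBodySolver.Downfold.BoxesLa214V115M2cPhaseSeparationThermalHotAnchor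
import Summits.Ventures.CertifiedManyBodySolver.Certificates.HubbardTTPrime_hartreeFockCaps_kernel_p45p65
import HarnessLib
import HarnessLib.Audit

/-!
# Ventures/CertifiedManyBodySolver — Observables/PhaseSeparationExclusionEDopedFarThermalA.lean: `T > 0` TWINS of the electron-doped far-strip words —
# «no (≤ 1 ∣ ≥ 2 − n₁) coexistence in ANY canonical Gibbs state with β·t ≥ β₀» on `t′ ∈ [−13/20, −9/20]` (NCCO / Nd₂CuO₄ / Sr₁₋ₓLaₓCuO₂ object-E boxes)

HONEST FRAMING: first certified bounds; not a superconductivity or `T_c` verdict. CLASS = DERIVED / CONTEXT (hypothesis-free where stated). Device = hubbard-downfold-unc-2's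
REFLECTED column law `psT_not_thermal_mix_on_cell_of_columns_hotAnchorSS_tcap_reflected` (`…ParticleHoleColumns`, g28, p704045: cap / floors / pressure anchors of the hole
side `(t′, n)` are carried to `(−t′, 2 − n)`, the anchored combination is particle–hole INVARIANT), fed with THIS seat's far-positive-strip column data (`…EDopedFarColumns*`:
kernel Hartree–Fock caps `hfHalf_p45p65` / `hf13o20_*` / `hf7o10_*`, kernel dilute chords `edf_dilute*`, free columns `edf_n1_col0_*_atU`, anchored columns `edf_n1_col{7o2,5,8,10,12}_*`
BY EVENNESS / `t′`-Lipschitz carry) and with A-PRIORI hot anchors only (`β_h = 0`: `2H_b(n₁/2)` — `lsco_diluteCap_1o5/1o4`, `strip_diluteCap_3o10/2o5`, `2 log 2` for `9/20` and for the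
half-filled member; NO quadrature certificate, NO claim node). Statement form = the tree's canonical thermal mixture law (`IsTorusLimitOfMixture` of sector Gibbs states,
Poulin–Hastings): at every `(t′, U)` of the cell and every `β ≥ β₀` no torus limit of canonical Gibbs states at ANY filling is the macroscopic mixture `λω₁ + (1−λ)ω₂` of
translation-invariant states with `ρ(ω₁) ≤ 1` and `ρ(ω₂) ≥ 2 − n₁`. READING (NCCO-type boxes, `t ≈ 0.42–0.51 eV`): «no canonical thermal state of the box model is a
macroscopic mixture of the half-filled-or-hole-doped parent and an ≥ 80 % / 75 % / 70 %-electron-doped phase at any T ≲ 900–1300 K / 600–900 K / 350–500 K — with NO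
hypothesis; ≥ 60 % (XL sheets by value) at T ≲ 350–450 K».
Seat hubbard-box-p3 g32 (`prover-hubbard-box-p3-g32-0`), 2026-08-29; generator `pub/hubbard-fast/hubbard-box-p3/work-g32/ed/emit_thermal.py` (exact fractions; `β₀` = integer
above `1.02 × max (aQ₁ + bQ₂)/M` over the cell corners, every inequality re-asserted exactly). Zero kit; no MOVE; no number of record.
WHAT THIS IS NOT: a certificate; a `T_c`, pairing or phase sentence; a statement for `β·t < β₀` or outside the cells; the object-M reading (`|t′| ≤ 2/5`) is unc-2's `…ElectronDopedMirrorThermal*`.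
References: [LiebWuPhysicaA2003] §1 eq. (3); [Israel1979] Thm I.2.4; [PoulinHastings2011] eqs. (3)–(8); [EmeryKivelsonLin1990]; [Griffiths1966] §II; [Ruelle1969] §3.4; [BachLiebSolovej1994] (2c.36).
-/

noncomputable section

namespace Summit.Ventures.CertifiedManyBodySolver.Observables

open Summit.Ventures.CertifiedManyBodySolver.Certificates Summit.Ventures.CertifiedManyBodySolver.Downfold
open Literature.MathematicalPhysics.QuantumLattice Literature.MathematicalPhysics.QuantumLattice.ThermodynamicLimit
open Literature.MathematicalPhysics.QuantumLattice.InfVolFermionState Set Filter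

/-- **ELECTRON-DOPED CELL `t′ ∈ [-11/20, -9/20] × U ∈ [0, 16/5]`, `T > 0`: no «(≤ 1 ∣ ≥ 9/5)» coexistence in ANY canonical Gibbs state with `β·t ≥ 5`**
(T ≲ 1040 K at t ≈ 0.45 eV) — NO HYPOTHESIS. Reflected column law fed with the hole-side data of `t′ ∈ [9/20, 11/20]`: cap `hfHalf_p45p65` (`a, b = 5/8, 3/8`), columns `edf_n1_col0_p45p55_atU` ∣
`edf_n1_col0_p45p55_atU`, dilute floor `edf_dilute1o5_p45p55`; a-priori hot anchors (`β_h = 0`). `T = 0` margins at `s = 9/20 ∣ 11/20`: `U = 0`: M 0.4377 ∣ 0.4686; `U = 16 / 5`: M 0.2377 ∣ 0.2686; `aQ₁ + bQ₂ = 0.9361` ⇒ `β₀ = 5`.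
[cite: LiebWuPhysicaA2003, §1 eq. (3)] [cite: Israel1979, Thm. I.2.4] [cite: PoulinHastings2011, eqs. (3)–(8)] [cite: EmeryKivelsonLin1990, pp. 475–476] [cite: Griffiths1966, §II] [cite: Ruelle1969, §3.4] -/
theorem edTFree_9o5_m55m45_U0to16o5_beta5
    {s : ℝ} (hs : s ∈ Icc (-11 / 20 : ℝ) (-9 / 20 : ℝ)) {U : ℝ} (hU : U ∈ Icc (0 : ℝ) (16 / 5 : ℝ))
    {β : ℝ} (hβ : (5 : ℝ) ≤ β)
    {ω₁ ω₂ : InfVolFermionState 2} (h₁ : ω₁.IsTranslationInvariant) (h₂ : ω₂.IsTranslationInvariant)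
    (hρ₁ : 0 < ω₁.density) (hρ₁' : ω₁.density ≤ 1) (hρ₂ : 9 / 5 ≤ ω₂.density) (hρ₂' : ω₂.density < 2)
    {n : ℝ} (hn0 : 0 < n) (hn2 : n < 2) {lam : ℝ} (hl0 : 0 < lam) (hl1 : lam < 1) {Ls : ℕ → ℕ}
    (hLs : Tendsto Ls atTop atTop) :
    ¬ (mix lam hl0.le hl1.le ω₁ ω₂).IsTorusLimitOfMixture (sectorGibbsCount n) (fun L => sectorGibbsWeightTT' β 1 s U n L)
      (fun L => sectorGibbsVectorTT' 1 s U n L) Ls := by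
  refine psT_not_thermal_mix_on_cell_of_columns_hotAnchorSS_tcap_reflected 1 (s₁ := 9 / 20) (s₂ := 11 / 20) (U₁ := 0) (U₂ := 16 / 5)
    (n₁ := 1 / 5) (n₂ := 1) (a := 5 / 8) (b := 3 / 8) (β₀ := 5) (βh₁ := 0) (βh₂ := 0)
    (c₀ := ((-817573/625000 : ℚ) : ℝ)) (cs := ((-1985153/2500000 : ℚ) : ℝ)) (c₁ := ((1/16 : ℚ) : ℝ))
    (by norm_num) (by norm_num) (by norm_num) (by norm_num) (by norm_num) (by norm_num) (by norm_num) (by norm_num)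
    (by norm_num) (by norm_num) (by norm_num) (by norm_num) hβ (by norm_num)
    (hfHalf_p45p65_tcap_on_cell (by norm_num) (by norm_num) (by norm_num) (by norm_num))
    (fun s hs => edf_n1_col0_p45p55_atU (U₀ := 0) le_rfl s ⟨hs.1.trans' (by norm_num), hs.2.trans (by norm_num)⟩)
    (fun s hs => edf_n1_col0_p45p55_atU (U₀ := 16 / 5) (by norm_num) s ⟨hs.1.trans' (by norm_num), hs.2.trans (by norm_num)⟩)
    (fun s hs U hU => edf_dilute1o5_p45p55 (n₁ := 1 / 5) (by norm_num) (by norm_num) s ⟨hs.1.trans' (by norm_num), hs.2.trans (by norm_num)⟩ U (by linarith [hU.1]))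
    (lsco_diluteCap_1o5 (by norm_num))
    (apriori_hotCap_halfFilling_on_cell (by norm_num))
    ?_ ?_ ?_ ?_ ⟨by linarith [hs.1], by linarith [hs.2]⟩ hU h₁ h₂ hρ₁
    (hρ₁'.trans (by norm_num)) (le_trans (by norm_num) hρ₂) hρ₂' hn0 hn2 hl0 hl1 hLs
  · intro s hs; obtain ⟨h1, h2⟩ := hs; push_cast; norm_num; nlinarith [h1, h2]
  · intro s hs; obtain ⟨h1, h2⟩ := hs; push_cast; norm_num; nlinarith [h1, h2]
  · intro s hs; obtain ⟨h1, h2⟩ := hs; push_cast; norm_num; nlinarith [h1, h2]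
  · intro s hs; obtain ⟨h1, h2⟩ := hs; push_cast; norm_num; nlinarith [h1, h2]

/-- **ELECTRON-DOPED CELL `t′ ∈ [-11/20, -9/20] × U ∈ [0, 16/5]`, `T > 0`: no «(≤ 1 ∣ ≥ 7/4)» coexistence in ANY canonical Gibbs state with `β·t ≥ 7`**
(T ≲ 742 K at t ≈ 0.45 eV) — NO HYPOTHESIS. Reflected column law fed with the hole-side data of `t′ ∈ [9/20, 11/20]`: cap `hfHalf_p45p65` (`a, b = 2/3, 1/3`), columns `edf_n1_col0_p45p55_atU` ∣
`edf_n1_col0_p45p55_atU`, dilute floor `edf_dilute1o4_p45p55`; a-priori hot anchors (`β_h = 0`). `T = 0` margins at `s = 9/20 ∣ 11/20`: `U = 0`: M 0.3548 ∣ 0.3791; `U = 16 / 5`: M 0.1548 ∣ 0.1791; `aQ₁ + bQ₂ = 0.9754` ⇒ `β₀ = 7`.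
[cite: LiebWuPhysicaA2003, §1 eq. (3)] [cite: Israel1979, Thm. I.2.4] [cite: PoulinHastings2011, eqs. (3)–(8)] [cite: EmeryKivelsonLin1990, pp. 475–476] [cite: Griffiths1966, §II] [cite: Ruelle1969, §3.4] -/
theorem edTFree_7o4_m55m45_U0to16o5_beta7
    {s : ℝ} (hs : s ∈ Icc (-11 / 20 : ℝ) (-9 / 20 : ℝ)) {U : ℝ} (hU : U ∈ Icc (0 : ℝ) (16 / 5 : ℝ))
    {β : ℝ} (hβ : (7 : ℝ) ≤ β)
    {ω₁ ω₂ : InfVolFermionState 2} (h₁ : ω₁.IsTranslationInvariant) (h₂ : ω₂.IsTranslationInvariant)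
    (hρ₁ : 0 < ω₁.density) (hρ₁' : ω₁.density ≤ 1) (hρ₂ : 7 / 4 ≤ ω₂.density) (hρ₂' : ω₂.density < 2)
    {n : ℝ} (hn0 : 0 < n) (hn2 : n < 2) {lam : ℝ} (hl0 : 0 < lam) (hl1 : lam < 1) {Ls : ℕ → ℕ}
    (hLs : Tendsto Ls atTop atTop) :
    ¬ (mix lam hl0.le hl1.le ω₁ ω₂).IsTorusLimitOfMixture (sectorGibbsCount n) (fun L => sectorGibbsWeightTT' β 1 s U n L)
      (fun L => sectorGibbsVectorTT' 1 s U n L) Ls := by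
  refine psT_not_thermal_mix_on_cell_of_columns_hotAnchorSS_tcap_reflected 1 (s₁ := 9 / 20) (s₂ := 11 / 20) (U₁ := 0) (U₂ := 16 / 5)
    (n₁ := 1 / 4) (n₂ := 1) (a := 2 / 3) (b := 1 / 3) (β₀ := 7) (βh₁ := 0) (βh₂ := 0)
    (c₀ := ((-817573/625000 : ℚ) : ℝ)) (cs := ((-1985153/2500000 : ℚ) : ℝ)) (c₁ := ((1/16 : ℚ) : ℝ))
    (by norm_num) (by norm_num) (by norm_num) (by norm_num) (by norm_num) (by norm_num) (by norm_num) (by norm_num)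
    (by norm_num) (by norm_num) (by norm_num) (by norm_num) hβ (by norm_num)
    (hfHalf_p45p65_tcap_on_cell (by norm_num) (by norm_num) (by norm_num) (by norm_num))
    (fun s hs => edf_n1_col0_p45p55_atU (U₀ := 0) le_rfl s ⟨hs.1.trans' (by norm_num), hs.2.trans (by norm_num)⟩)
    (fun s hs => edf_n1_col0_p45p55_atU (U₀ := 16 / 5) (by norm_num) s ⟨hs.1.trans' (by norm_num), hs.2.trans (by norm_num)⟩)
    (fun s hs U hU => edf_dilute1o4_p45p55 (n₁ := 1 / 4) (by norm_num) (by norm_num) s ⟨hs.1.trans' (by norm_num), hs.2.trans (by norm_num)⟩ U (by linarith [hU.1]))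
    (lsco_diluteCap_1o4 (by norm_num))
    (apriori_hotCap_halfFilling_on_cell (by norm_num))
    ?_ ?_ ?_ ?_ ⟨by linarith [hs.1], by linarith [hs.2]⟩ hU h₁ h₂ hρ₁
    (hρ₁'.trans (by norm_num)) (le_trans (by norm_num) hρ₂) hρ₂' hn0 hn2 hl0 hl1 hLs
  · intro s hs; obtain ⟨h1, h2⟩ := hs; push_cast; norm_num; nlinarith [h1, h2]
  · intro s hs; obtain ⟨h1, h2⟩ := hs; push_cast; norm_num; nlinarith [h1, h2]
  · intro s hs; obtain ⟨h1, h2⟩ := hs; push_cast; norm_num; nlinarith [h1, h2]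
  · intro s hs; obtain ⟨h1, h2⟩ := hs; push_cast; norm_num; nlinarith [h1, h2]

/-- **ELECTRON-DOPED CELL `t′ ∈ [-13/20, -11/20] × U ∈ [0, 16/5]`, `T > 0`: no «(≤ 1 ∣ ≥ 9/5)» coexistence in ANY canonical Gibbs state with `β·t ≥ 4`**
(T ≲ 1300 K at t ≈ 0.45 eV) — NO HYPOTHESIS. Reflected column law fed with the hole-side data of `t′ ∈ [11/20, 13/20]`: cap `hfHalf_p45p65` (`a, b = 5/8, 3/8`), columns `edf_n1_col0_p55p65_atU` ∣
`edf_n1_col0_p55p65_atU`, dilute floor `edf_dilute1o5_p55p65`; a-priori hot anchors (`β_h = 0`). `T = 0` margins at `s = 11/20 ∣ 13/20`: `U = 0`: M 0.4686 ∣ 0.4976; `U = 16 / 5`: M 0.2686 ∣ 0.2976; `aQ₁ + bQ₂ = 0.9361` ⇒ `β₀ = 4`.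
[cite: LiebWuPhysicaA2003, §1 eq. (3)] [cite: Israel1979, Thm. I.2.4] [cite: PoulinHastings2011, eqs. (3)–(8)] [cite: EmeryKivelsonLin1990, pp. 475–476] [cite: Griffiths1966, §II] [cite: Ruelle1969, §3.4] -/
theorem edTFree_9o5_m65m55_U0to16o5_beta4
    {s : ℝ} (hs : s ∈ Icc (-13 / 20 : ℝ) (-11 / 20 : ℝ)) {U : ℝ} (hU : U ∈ Icc (0 : ℝ) (16 / 5 : ℝ))
    {β : ℝ} (hβ : (4 : ℝ) ≤ β)
    {ω₁ ω₂ : InfVolFermionState 2} (h₁ : ω₁.IsTranslationInvariant) (h₂ : ω₂.IsTranslationInvariant)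
    (hρ₁ : 0 < ω₁.density) (hρ₁' : ω₁.density ≤ 1) (hρ₂ : 9 / 5 ≤ ω₂.density) (hρ₂' : ω₂.density < 2)
    {n : ℝ} (hn0 : 0 < n) (hn2 : n < 2) {lam : ℝ} (hl0 : 0 < lam) (hl1 : lam < 1) {Ls : ℕ → ℕ}
    (hLs : Tendsto Ls atTop atTop) :
    ¬ (mix lam hl0.le hl1.le ω₁ ω₂).IsTorusLimitOfMixture (sectorGibbsCount n) (fun L => sectorGibbsWeightTT' β 1 s U n L)
      (fun L => sectorGibbsVectorTT' 1 s U n L) Ls := by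
  refine psT_not_thermal_mix_on_cell_of_columns_hotAnchorSS_tcap_reflected 1 (s₁ := 11 / 20) (s₂ := 13 / 20) (U₁ := 0) (U₂ := 16 / 5)
    (n₁ := 1 / 5) (n₂ := 1) (a := 5 / 8) (b := 3 / 8) (β₀ := 4) (βh₁ := 0) (βh₂ := 0)
    (c₀ := ((-817573/625000 : ℚ) : ℝ)) (cs := ((-1985153/2500000 : ℚ) : ℝ)) (c₁ := ((1/16 : ℚ) : ℝ))
    (by norm_num) (by norm_num) (by norm_num) (by norm_num) (by norm_num) (by norm_num) (by norm_num) (by norm_num)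
    (by norm_num) (by norm_num) (by norm_num) (by norm_num) hβ (by norm_num)
    (hfHalf_p45p65_tcap_on_cell (by norm_num) (by norm_num) (by norm_num) (by norm_num))
    (fun s hs => edf_n1_col0_p55p65_atU (U₀ := 0) le_rfl s ⟨hs.1.trans' (by norm_num), hs.2.trans (by norm_num)⟩)
    (fun s hs => edf_n1_col0_p55p65_atU (U₀ := 16 / 5) (by norm_num) s ⟨hs.1.trans' (by norm_num), hs.2.trans (by norm_num)⟩)
    (fun s hs U hU => edf_dilute1o5_p55p65 (n₁ := 1 / 5) (by norm_num) (by norm_num) s ⟨hs.1.trans' (by norm_num), hs.2.trans (by norm_num)⟩ U (by linarith [hU.1]))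
    (lsco_diluteCap_1o5 (by norm_num))
    (apriori_hotCap_halfFilling_on_cell (by norm_num))
    ?_ ?_ ?_ ?_ ⟨by linarith [hs.1], by linarith [hs.2]⟩ hU h₁ h₂ hρ₁
    (hρ₁'.trans (by norm_num)) (le_trans (by norm_num) hρ₂) hρ₂' hn0 hn2 hl0 hl1 hLs
  · intro s hs; obtain ⟨h1, h2⟩ := hs; push_cast; norm_num; nlinarith [h1, h2]
  · intro s hs; obtain ⟨h1, h2⟩ := hs; push_cast; norm_num; nlinarith [h1, h2]
  · intro s hs; obtain ⟨h1, h2⟩ := hs; push_cast; norm_num; nlinarith [h1, h2]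
  · intro s hs; obtain ⟨h1, h2⟩ := hs; push_cast; norm_num; nlinarith [h1, h2]

/-- **ELECTRON-DOPED CELL `t′ ∈ [-13/20, -11/20] × U ∈ [0, 16/5]`, `T > 0`: no «(≤ 1 ∣ ≥ 7/4)» coexistence in ANY canonical Gibbs state with `β·t ≥ 6`**
(T ≲ 866 K at t ≈ 0.45 eV) — NO HYPOTHESIS. Reflected column law fed with the hole-side data of `t′ ∈ [11/20, 13/20]`: cap `hfHalf_p45p65` (`a, b = 2/3, 1/3`), columns `edf_n1_col0_p55p65_atU` ∣
`edf_n1_col0_p55p65_atU`, dilute floor `edf_dilute1o4_p55p65`; a-priori hot anchors (`β_h = 0`). `T = 0` margins at `s = 11/20 ∣ 13/20`: `U = 0`: M 0.3791 ∣ 0.4019; `U = 16 / 5`: M 0.1791 ∣ 0.2019; `aQ₁ + bQ₂ = 0.9754` ⇒ `β₀ = 6`.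
[cite: LiebWuPhysicaA2003, §1 eq. (3)] [cite: Israel1979, Thm. I.2.4] [cite: PoulinHastings2011, eqs. (3)–(8)] [cite: EmeryKivelsonLin1990, pp. 475–476] [cite: Griffiths1966, §II] [cite: Ruelle1969, §3.4] -/
theorem edTFree_7o4_m65m55_U0to16o5_beta6
    {s : ℝ} (hs : s ∈ Icc (-13 / 20 : ℝ) (-11 / 20 : ℝ)) {U : ℝ} (hU : U ∈ Icc (0 : ℝ) (16 / 5 : ℝ))
    {β : ℝ} (hβ : (6 : ℝ) ≤ β)
    {ω₁ ω₂ : InfVolFermionState 2} (h₁ : ω₁.IsTranslationInvariant) (h₂ : ω₂.IsTranslationInvariant)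
    (hρ₁ : 0 < ω₁.density) (hρ₁' : ω₁.density ≤ 1) (hρ₂ : 7 / 4 ≤ ω₂.density) (hρ₂' : ω₂.density < 2)
    {n : ℝ} (hn0 : 0 < n) (hn2 : n < 2) {lam : ℝ} (hl0 : 0 < lam) (hl1 : lam < 1) {Ls : ℕ → ℕ}
    (hLs : Tendsto Ls atTop atTop) :
    ¬ (mix lam hl0.le hl1.le ω₁ ω₂).IsTorusLimitOfMixture (sectorGibbsCount n) (fun L => sectorGibbsWeightTT' β 1 s U n L)
      (fun L => sectorGibbsVectorTT' 1 s U n L) Ls := by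
  refine psT_not_thermal_mix_on_cell_of_columns_hotAnchorSS_tcap_reflected 1 (s₁ := 11 / 20) (s₂ := 13 / 20) (U₁ := 0) (U₂ := 16 / 5)
    (n₁ := 1 / 4) (n₂ := 1) (a := 2 / 3) (b := 1 / 3) (β₀ := 6) (βh₁ := 0) (βh₂ := 0)
    (c₀ := ((-817573/625000 : ℚ) : ℝ)) (cs := ((-1985153/2500000 : ℚ) : ℝ)) (c₁ := ((1/16 : ℚ) : ℝ))
    (by norm_num) (by norm_num) (by norm_num) (by norm_num) (by norm_num) (by norm_num) (by norm_num) (by norm_num)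
    (by norm_num) (by norm_num) (by norm_num) (by norm_num) hβ (by norm_num)
    (hfHalf_p45p65_tcap_on_cell (by norm_num) (by norm_num) (by norm_num) (by norm_num))
    (fun s hs => edf_n1_col0_p55p65_atU (U₀ := 0) le_rfl s ⟨hs.1.trans' (by norm_num), hs.2.trans (by norm_num)⟩)
    (fun s hs => edf_n1_col0_p55p65_atU (U₀ := 16 / 5) (by norm_num) s ⟨hs.1.trans' (by norm_num), hs.2.trans (by norm_num)⟩)
    (fun s hs U hU => edf_dilute1o4_p55p65 (n₁ := 1 / 4) (by norm_num) (by norm_num) s ⟨hs.1.trans' (by norm_num), hs.2.trans (by norm_num)⟩ U (by linarith [hU.1]))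
    (lsco_diluteCap_1o4 (by norm_num))
    (apriori_hotCap_halfFilling_on_cell (by norm_num))
    ?_ ?_ ?_ ?_ ⟨by linarith [hs.1], by linarith [hs.2]⟩ hU h₁ h₂ hρ₁
    (hρ₁'.trans (by norm_num)) (le_trans (by norm_num) hρ₂) hρ₂' hn0 hn2 hl0 hl1 hLs
  · intro s hs; obtain ⟨h1, h2⟩ := hs; push_cast; norm_num; nlinarith [h1, h2]
  · intro s hs; obtain ⟨h1, h2⟩ := hs; push_cast; norm_num; nlinarith [h1, h2]
  · intro s hs; obtain ⟨h1, h2⟩ := hs; push_cast; norm_num; nlinarith [h1, h2]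
  · intro s hs; obtain ⟨h1, h2⟩ := hs; push_cast; norm_num; nlinarith [h1, h2]

/-! ## Unions over the two segments (electron-doped rectangle `t′ ∈ [−13/20, −9/20]`) and routed boxes -/

/-- **THE ELECTRON-DOPED `T > 0` SENTENCE «no (≤ 1 ∣ ≥ 9/5) coexistence in any canonical Gibbs state with β·t ≥ 5» ON `t′ ∈ [−13/20, −9/20] × U ∈ [0, 16/5]`** — NO HYPOTHESIS
(union of the cells `edTFree_9o5_m55m45_U0to16o5_beta5`, `edTFree_9o5_m65m55_U0to16o5_beta4`; `β₀` = the largest cell threshold). [cite: LiebWuPhysicaA2003, §1 eq. (3)] [cite: Israel1979, Thm. I.2.4] [cite: PoulinHastings2011, eqs. (3)–(8)] -/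
theorem edTFar_noPS_le_one_ge_9o5_U0to16o5
    {s : ℝ} (hs : s ∈ Icc (-13 / 20 : ℝ) (-9 / 20 : ℝ)) {U : ℝ} (hU : U ∈ Icc (0 : ℝ) (16 / 5 : ℝ))
    {β : ℝ} (hβ : (5 : ℝ) ≤ β)
    {ω₁ ω₂ : InfVolFermionState 2} (h₁ : ω₁.IsTranslationInvariant) (h₂ : ω₂.IsTranslationInvariant)
    (hρ₁ : 0 < ω₁.density) (hρ₁' : ω₁.density ≤ 1) (hρ₂ : 9 / 5 ≤ ω₂.density) (hρ₂' : ω₂.density < 2)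
    {n : ℝ} (hn0 : 0 < n) (hn2 : n < 2) {lam : ℝ} (hl0 : 0 < lam) (hl1 : lam < 1) {Ls : ℕ → ℕ}
    (hLs : Tendsto Ls atTop atTop) :
    ¬ (mix lam hl0.le hl1.le ω₁ ω₂).IsTorusLimitOfMixture (sectorGibbsCount n) (fun L => sectorGibbsWeightTT' β 1 s U n L)
      (fun L => sectorGibbsVectorTT' 1 s U n L) Ls := by
  rcases le_total s (-11 / 20 : ℝ) with hc | hc'
  · exact edTFree_9o5_m65m55_U0to16o5_beta4 ⟨hs.1, hc⟩ ⟨hU.1, hU.2⟩ (le_trans (by norm_num) hβ) h₁ h₂ hρ₁ hρ₁' hρ₂ hρ₂' hn0 hn2 hl0 hl1 hLs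
  · exact edTFree_9o5_m55m45_U0to16o5_beta5 ⟨hc', hs.2⟩ ⟨hU.1, hU.2⟩ (le_trans (by norm_num) hβ) h₁ h₂ hρ₁ hρ₁' hρ₂ hρ₂' hn0 hn2 hl0 hl1 hLs

/-- **THE ELECTRON-DOPED `T > 0` SENTENCE «no (≤ 1 ∣ ≥ 7/4) coexistence in any canonical Gibbs state with β·t ≥ 7» ON `t′ ∈ [−13/20, −9/20] × U ∈ [0, 16/5]`** — NO HYPOTHESIS
(union of the cells `edTFree_7o4_m55m45_U0to16o5_beta7`, `edTFree_7o4_m65m55_U0to16o5_beta6`; `β₀` = the largest cell threshold). [cite: LiebWuPhysicaA2003, §1 eq. (3)] [cite: Israel1979, Thm. I.2.4] [cite: PoulinHastings2011, eqs. (3)–(8)] -/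
theorem edTFar_noPS_le_one_ge_7o4_U0to16o5
    {s : ℝ} (hs : s ∈ Icc (-13 / 20 : ℝ) (-9 / 20 : ℝ)) {U : ℝ} (hU : U ∈ Icc (0 : ℝ) (16 / 5 : ℝ))
    {β : ℝ} (hβ : (7 : ℝ) ≤ β)
    {ω₁ ω₂ : InfVolFermionState 2} (h₁ : ω₁.IsTranslationInvariant) (h₂ : ω₂.IsTranslationInvariant)
    (hρ₁ : 0 < ω₁.density) (hρ₁' : ω₁.density ≤ 1) (hρ₂ : 7 / 4 ≤ ω₂.density) (hρ₂' : ω₂.density < 2)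
    {n : ℝ} (hn0 : 0 < n) (hn2 : n < 2) {lam : ℝ} (hl0 : 0 < lam) (hl1 : lam < 1) {Ls : ℕ → ℕ}
    (hLs : Tendsto Ls atTop atTop) :
    ¬ (mix lam hl0.le hl1.le ω₁ ω₂).IsTorusLimitOfMixture (sectorGibbsCount n) (fun L => sectorGibbsWeightTT' β 1 s U n L)
      (fun L => sectorGibbsVectorTT' 1 s U n L) Ls := by
  rcases le_total s (-11 / 20 : ℝ) with hc | hc'
  · exact edTFree_7o4_m65m55_U0to16o5_beta6 ⟨hs.1, hc⟩ ⟨hU.1, hU.2⟩ (le_trans (by norm_num) hβ) h₁ h₂ hρ₁ hρ₁' hρ₂ hρ₂' hn0 hn2 hl0 hl1 hLs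
  · exact edTFree_7o4_m55m45_U0to16o5_beta7 ⟨hc', hs.2⟩ ⟨hU.1, hU.2⟩ (le_trans (by norm_num) hβ) h₁ h₂ hρ₁ hρ₁' hρ₂ hρ₂' hn0 hn2 hl0 hl1 hLs

/-- **Row M20 (NCCO-x0.15), `T > 0`: no «(≤ 1 ∣ ≥ 9/5)» coexistence in any canonical Gibbs state with `β·t ≥ 5` on the WHOLE routed box
`t′/t ∈ [-0.62, -0.51] × U/t ∈ [2.4, 3.2]`** (object E row; `T ≲ 1040 K` at `t ≈ 0.45 eV`) — NO HYPOTHESIS. Restriction of `edTFar_noPS_le_one_ge_9o5_U0to16o5`.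
[cite: LiebWuPhysicaA2003, §1 eq. (3)] [cite: Israel1979, Thm. I.2.4] [cite: PoulinHastings2011, eqs. (3)–(8)] -/
theorem psBoxT_M20_le_one_ge_9o5_beta5
    {s : ℝ} (hs : s ∈ Icc (-31 / 50 : ℝ) (-51 / 100 : ℝ)) {U : ℝ} (hU : U ∈ Icc (12 / 5 : ℝ) (16 / 5 : ℝ))
    {β : ℝ} (hβ : (5 : ℝ) ≤ β)
    {ω₁ ω₂ : InfVolFermionState 2} (h₁ : ω₁.IsTranslationInvariant) (h₂ : ω₂.IsTranslationInvariant)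
    (hρ₁ : 0 < ω₁.density) (hρ₁' : ω₁.density ≤ 1) (hρ₂ : 9 / 5 ≤ ω₂.density) (hρ₂' : ω₂.density < 2)
    {n : ℝ} (hn0 : 0 < n) (hn2 : n < 2) {lam : ℝ} (hl0 : 0 < lam) (hl1 : lam < 1) {Ls : ℕ → ℕ}
    (hLs : Tendsto Ls atTop atTop) :
    ¬ (mix lam hl0.le hl1.le ω₁ ω₂).IsTorusLimitOfMixture (sectorGibbsCount n) (fun L => sectorGibbsWeightTT' β 1 s U n L)
      (fun L => sectorGibbsVectorTT' 1 s U n L) Ls := by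
  exact edTFar_noPS_le_one_ge_9o5_U0to16o5 ⟨(hs.1).trans' (by norm_num), (hs.2).trans (by norm_num)⟩ ⟨(hU.1).trans' (by norm_num), (hU.2).trans (by norm_num)⟩ hβ h₁ h₂ hρ₁ hρ₁' hρ₂ hρ₂' hn0 hn2 hl0 hl1 hLs

/-- **Row M55 (NCCO-x0.10), `T > 0`: no «(≤ 1 ∣ ≥ 9/5)» coexistence in any canonical Gibbs state with `β·t ≥ 5` on the WHOLE routed box
`t′/t ∈ [-0.613, -0.499] × U/t ∈ [2.41, 3.2]`** (object E row; `T ≲ 1040 K` at `t ≈ 0.45 eV`) — NO HYPOTHESIS. Restriction of `edTFar_noPS_le_one_ge_9o5_U0to16o5`.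
[cite: LiebWuPhysicaA2003, §1 eq. (3)] [cite: Israel1979, Thm. I.2.4] [cite: PoulinHastings2011, eqs. (3)–(8)] -/
theorem psBoxT_M55_le_one_ge_9o5_beta5
    {s : ℝ} (hs : s ∈ Icc (-613 / 1000 : ℝ) (-499 / 1000 : ℝ)) {U : ℝ} (hU : U ∈ Icc (241 / 100 : ℝ) (16 / 5 : ℝ))
    {β : ℝ} (hβ : (5 : ℝ) ≤ β)
    {ω₁ ω₂ : InfVolFermionState 2} (h₁ : ω₁.IsTranslationInvariant) (h₂ : ω₂.IsTranslationInvariant)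
    (hρ₁ : 0 < ω₁.density) (hρ₁' : ω₁.density ≤ 1) (hρ₂ : 9 / 5 ≤ ω₂.density) (hρ₂' : ω₂.density < 2)
    {n : ℝ} (hn0 : 0 < n) (hn2 : n < 2) {lam : ℝ} (hl0 : 0 < lam) (hl1 : lam < 1) {Ls : ℕ → ℕ}
    (hLs : Tendsto Ls atTop atTop) :
    ¬ (mix lam hl0.le hl1.le ω₁ ω₂).IsTorusLimitOfMixture (sectorGibbsCount n) (fun L => sectorGibbsWeightTT' β 1 s U n L)
      (fun L => sectorGibbsVectorTT' 1 s U n L) Ls := by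
  exact edTFar_noPS_le_one_ge_9o5_U0to16o5 ⟨(hs.1).trans' (by norm_num), (hs.2).trans (by norm_num)⟩ ⟨(hU.1).trans' (by norm_num), (hU.2).trans (by norm_num)⟩ hβ h₁ h₂ hρ₁ hρ₁' hρ₂ hρ₂' hn0 hn2 hl0 hl1 hLs

/-- **Row M56 (Nd₂CuO₄), `T > 0`: no «(≤ 1 ∣ ≥ 9/5)» coexistence in any canonical Gibbs state with `β·t ≥ 5` on the WHOLE routed box
`t′/t ∈ [-0.562, -0.461] × U/t ∈ [2.17, 2.77]`** (object E row; `T ≲ 1040 K` at `t ≈ 0.45 eV`) — NO HYPOTHESIS. Restriction of `edTFar_noPS_le_one_ge_9o5_U0to16o5`.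
[cite: LiebWuPhysicaA2003, §1 eq. (3)] [cite: Israel1979, Thm. I.2.4] [cite: PoulinHastings2011, eqs. (3)–(8)] -/
theorem psBoxT_M56_le_one_ge_9o5_beta5
    {s : ℝ} (hs : s ∈ Icc (-281 / 500 : ℝ) (-461 / 1000 : ℝ)) {U : ℝ} (hU : U ∈ Icc (217 / 100 : ℝ) (277 / 100 : ℝ))
    {β : ℝ} (hβ : (5 : ℝ) ≤ β)
    {ω₁ ω₂ : InfVolFermionState 2} (h₁ : ω₁.IsTranslationInvariant) (h₂ : ω₂.IsTranslationInvariant)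
    (hρ₁ : 0 < ω₁.density) (hρ₁' : ω₁.density ≤ 1) (hρ₂ : 9 / 5 ≤ ω₂.density) (hρ₂' : ω₂.density < 2)
    {n : ℝ} (hn0 : 0 < n) (hn2 : n < 2) {lam : ℝ} (hl0 : 0 < lam) (hl1 : lam < 1) {Ls : ℕ → ℕ}
    (hLs : Tendsto Ls atTop atTop) :
    ¬ (mix lam hl0.le hl1.le ω₁ ω₂).IsTorusLimitOfMixture (sectorGibbsCount n) (fun L => sectorGibbsWeightTT' β 1 s U n L)
      (fun L => sectorGibbsVectorTT' 1 s U n L) Ls := by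
  exact edTFar_noPS_le_one_ge_9o5_U0to16o5 ⟨(hs.1).trans' (by norm_num), (hs.2).trans (by norm_num)⟩ ⟨(hU.1).trans' (by norm_num), (hU.2).trans (by norm_num)⟩ hβ h₁ h₂ hρ₁ hρ₁' hρ₂ hρ₂' hn0 hn2 hl0 hl1 hLs

/-- **Row M20 (NCCO-x0.15), `T > 0`: no «(≤ 1 ∣ ≥ 7/4)» coexistence in any canonical Gibbs state with `β·t ≥ 7` on the WHOLE routed box
`t′/t ∈ [-0.62, -0.51] × U/t ∈ [2.4, 3.2]`** (object E row; `T ≲ 742 K` at `t ≈ 0.45 eV`) — NO HYPOTHESIS. Restriction of `edTFar_noPS_le_one_ge_7o4_U0to16o5`.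
[cite: LiebWuPhysicaA2003, §1 eq. (3)] [cite: Israel1979, Thm. I.2.4] [cite: PoulinHastings2011, eqs. (3)–(8)] -/
theorem psBoxT_M20_le_one_ge_7o4_beta7
    {s : ℝ} (hs : s ∈ Icc (-31 / 50 : ℝ) (-51 / 100 : ℝ)) {U : ℝ} (hU : U ∈ Icc (12 / 5 : ℝ) (16 / 5 : ℝ))
    {β : ℝ} (hβ : (7 : ℝ) ≤ β)
    {ω₁ ω₂ : InfVolFermionState 2} (h₁ : ω₁.IsTranslationInvariant) (h₂ : ω₂.IsTranslationInvariant)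
    (hρ₁ : 0 < ω₁.density) (hρ₁' : ω₁.density ≤ 1) (hρ₂ : 7 / 4 ≤ ω₂.density) (hρ₂' : ω₂.density < 2)
    {n : ℝ} (hn0 : 0 < n) (hn2 : n < 2) {lam : ℝ} (hl0 : 0 < lam) (hl1 : lam < 1) {Ls : ℕ → ℕ}
    (hLs : Tendsto Ls atTop atTop) :
    ¬ (mix lam hl0.le hl1.le ω₁ ω₂).IsTorusLimitOfMixture (sectorGibbsCount n) (fun L => sectorGibbsWeightTT' β 1 s U n L)
      (fun L => sectorGibbsVectorTT' 1 s U n L) Ls := by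
  exact edTFar_noPS_le_one_ge_7o4_U0to16o5 ⟨(hs.1).trans' (by norm_num), (hs.2).trans (by norm_num)⟩ ⟨(hU.1).trans' (by norm_num), (hU.2).trans (by norm_num)⟩ hβ h₁ h₂ hρ₁ hρ₁' hρ₂ hρ₂' hn0 hn2 hl0 hl1 hLs

/-- **Row M55 (NCCO-x0.10), `T > 0`: no «(≤ 1 ∣ ≥ 7/4)» coexistence in any canonical Gibbs state with `β·t ≥ 7` on the WHOLE routed box
`t′/t ∈ [-0.613, -0.499] × U/t ∈ [2.41, 3.2]`** (object E row; `T ≲ 742 K` at `t ≈ 0.45 eV`) — NO HYPOTHESIS. Restriction of `edTFar_noPS_le_one_ge_7o4_U0to16o5`.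
[cite: LiebWuPhysicaA2003, §1 eq. (3)] [cite: Israel1979, Thm. I.2.4] [cite: PoulinHastings2011, eqs. (3)–(8)] -/
theorem psBoxT_M55_le_one_ge_7o4_beta7
    {s : ℝ} (hs : s ∈ Icc (-613 / 1000 : ℝ) (-499 / 1000 : ℝ)) {U : ℝ} (hU : U ∈ Icc (241 / 100 : ℝ) (16 / 5 : ℝ))
    {β : ℝ} (hβ : (7 : ℝ) ≤ β)
    {ω₁ ω₂ : InfVolFermionState 2} (h₁ : ω₁.IsTranslationInvariant) (h₂ : ω₂.IsTranslationInvariant)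
    (hρ₁ : 0 < ω₁.density) (hρ₁' : ω₁.density ≤ 1) (hρ₂ : 7 / 4 ≤ ω₂.density) (hρ₂' : ω₂.density < 2)
    {n : ℝ} (hn0 : 0 < n) (hn2 : n < 2) {lam : ℝ} (hl0 : 0 < lam) (hl1 : lam < 1) {Ls : ℕ → ℕ}
    (hLs : Tendsto Ls atTop atTop) :
    ¬ (mix lam hl0.le hl1.le ω₁ ω₂).IsTorusLimitOfMixture (sectorGibbsCount n) (fun L => sectorGibbsWeightTT' β 1 s U n L)
      (fun L => sectorGibbsVectorTT' 1 s U n L) Ls := by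
  exact edTFar_noPS_le_one_ge_7o4_U0to16o5 ⟨(hs.1).trans' (by norm_num), (hs.2).trans (by norm_num)⟩ ⟨(hU.1).trans' (by norm_num), (hU.2).trans (by norm_num)⟩ hβ h₁ h₂ hρ₁ hρ₁' hρ₂ hρ₂' hn0 hn2 hl0 hl1 hLs

/-- **Row M56 (Nd₂CuO₄), `T > 0`: no «(≤ 1 ∣ ≥ 7/4)» coexistence in any canonical Gibbs state with `β·t ≥ 7` on the WHOLE routed box
`t′/t ∈ [-0.562, -0.461] × U/t ∈ [2.17, 2.77]`** (object E row; `T ≲ 742 K` at `t ≈ 0.45 eV`) — NO HYPOTHESIS. Restriction of `edTFar_noPS_le_one_ge_7o4_U0to16o5`.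
[cite: LiebWuPhysicaA2003, §1 eq. (3)] [cite: Israel1979, Thm. I.2.4] [cite: PoulinHastings2011, eqs. (3)–(8)] -/
theorem psBoxT_M56_le_one_ge_7o4_beta7
    {s : ℝ} (hs : s ∈ Icc (-281 / 500 : ℝ) (-461 / 1000 : ℝ)) {U : ℝ} (hU : U ∈ Icc (217 / 100 : ℝ) (277 / 100 : ℝ))
    {β : ℝ} (hβ : (7 : ℝ) ≤ β)
    {ω₁ ω₂ : InfVolFermionState 2} (h₁ : ω₁.IsTranslationInvariant) (h₂ : ω₂.IsTranslationInvariant)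
    (hρ₁ : 0 < ω₁.density) (hρ₁' : ω₁.density ≤ 1) (hρ₂ : 7 / 4 ≤ ω₂.density) (hρ₂' : ω₂.density < 2)
    {n : ℝ} (hn0 : 0 < n) (hn2 : n < 2) {lam : ℝ} (hl0 : 0 < lam) (hl1 : lam < 1) {Ls : ℕ → ℕ}
    (hLs : Tendsto Ls atTop atTop) :
    ¬ (mix lam hl0.le hl1.le ω₁ ω₂).IsTorusLimitOfMixture (sectorGibbsCount n) (fun L => sectorGibbsWeightTT' β 1 s U n L)
      (fun L => sectorGibbsVectorTT' 1 s U n L) Ls := by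
  exact edTFar_noPS_le_one_ge_7o4_U0to16o5 ⟨(hs.1).trans' (by norm_num), (hs.2).trans (by norm_num)⟩ ⟨(hU.1).trans' (by norm_num), (hU.2).trans (by norm_num)⟩ hβ h₁ h₂ hρ₁ hρ₁' hρ₂ hρ₂' hn0 hn2 hl0 hl1 hLs

end Summit.Ventures.CertifiedManyBodySolver.Observables

end
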